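import Literature.NumberTheory.Automorphic.UnitaryThreeAnisotropicStabilizerCoordinates   -- ★ FILE 1 (this seat)
import Literature.NumberTheory.Automorphic.UnitOrbitalIntegralUnfoldingAnisotropic         -- ★ (F2′): `mem_stabilizer_anisoVec_iff`
import Literature.NumberTheory.Automorphic.UnitaryGroupRankOneBigCell                     -- ★ `antidiagonal_three_over_eq`
import HarnessLib

/-!
# Realisability of the anisotropic stabiliser's coordinates: every `(b, q, r, s)` satisfying the three unitarity relations IS an element of `Stab(w₀)`, and
# `Stab(w₀) ↔ {(A, q, s) : N(s) + 4ϖN(q) = 1, N(A) = N(s)}` (Flicker 1998, Prop. 4 p. 82 — LAYER B′ step 2, FILE 2b-i)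

Topic `NumberTheory/Automorphic`; namespace `Literature.NumberTheory.Automorphic.UnitaryGroup`.  THEOREMS ONLY (no `def`, no instance, no notation, no named fact, no
`sorry`; count-neutral).  Cell `pub/hodgecm-mathlib`, F0∕P3a road «D-N7-inert», line «N7nsCount» ((F11-c)); B-p14 (g30) DESIGN v2 §Plan 2 (the coset space `S ⧸ H′_m`);
LEAD F0P3a-plan (g9) 06:07Z: «A-p13 holds (2a) + (2b-i) realisability + the coset-criterion glue».  HONEST LABEL: HC_CM is proved only modulo the printed citations
until rung 0 closes; coordinates here, no count.

THE MATHEMATICS.  ★ (C′) + ★ FILE 1 give the NECESSITY: `h ∈ Stab(w₀)` has the shape `M(b,q,r,s) = [[1+2ϖb, q, b], [2ϖr, s, r], [4ϖ²b, 2ϖq, 1+2ϖb]]` with (U1) `N(A) + 4ϖN(r) = 1`,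
(U2) `N(s) + 4ϖN(q) = 1`, (U3) `σA·q + σr·s = 0`, `A = 1 + 4ϖb`.  SUFFICIENCY (§1): for ANY `b q r s` with (U1)–(U3), `ᵗσM · Φ₃ · M = Φ₃` — the nine entries of the
product reduce to `ϖ·(U1)`, `2ϖ·(U3)`, `½(U1)`, `(U2)`, `σ(U3)` — so `M` is invertible, lies in `U(σ, Φ₃)`, and fixes `w₀ = (1, 0, −2ϖ)` identically
(**`exists_mem_stabilizer_coe_eq_of_relations`**).  §2: the relations (U1), (U3) FOLLOW from (U2), `N(A) = N(s)` and `r = −Aσq∕σs` (★ FILE 1 shows these are necessary),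
so **`Stab(w₀) ↔ {(A, q, s) : N(s) + 4ϖN(q) = 1 ∧ N(A) = N(s)}`** (`exists_mem_stabilizer_coe_eq_of_norm_relations`; uniqueness = ★ `stabilizer_ext_of_model`) — the
carrier over which B-p10 (g24)'s residue count ★ `natCard_quotient_pow_mul_natCard_norm_fibre` (`(q+1)q^{4m}`) is transported.

## References
* [Flicker1998UnitaryFL] Y. Z. Flicker, *Elementary proof of the fundamental lemma for a unitary group*, Canad. J. Math. 50 (1998), Prop. 4 pp. 80–82, Prop. 16 p. 96.
-/

set_option autoImplicit false

noncomputable section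

open scoped MatrixGroups WithZero
open Matrix

namespace Literature.NumberTheory.Automorphic

namespace UnitaryGroup

open Literature.NumberTheory.Automorphic.HermitianLattice

variable {K : Type*} [Field K] [Valued K ℤᵐ⁰] {ϖ : K}
  (σ : K →+* K) {J : Matrix (Fin 3) (Fin 3) K} (hJ : J = (StdForm.antidiagonal 3).over K)

/-! ## §1 Sufficiency of the three relations -/

omit [Valued K ℤᵐ⁰] in
/-- **`ᵗσM · Φ₃ · M = Φ₃`** for `M = M(b,q,r,s)` under (U1) `N(1+4ϖb) + 4ϖN(r) = 1`, (U2) `N(s) + 4ϖN(q) = 1`, (U3) `σ(1+4ϖb)·q + σr·s = 0` (`σ` an involution fixing `ϖ`,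
`2 ≠ 0`, `ϖ ≠ 0`): the nine entries are `ϖ·(U1)`, `2ϖ·(U3)`, `1 + ½((U1) − 1)`, `(U2)`, `2ϖ·σ(U3)`, `σ(U3)`, … . [cite: Flicker1998UnitaryFL, Prop. 4 p. 82] -/
theorem map_transpose_mul_antidiagonal_mul_eq_of_relations (hσσ : ∀ x, σ (σ x) = x) (hσϖ : σ ϖ = ϖ) (h2 : (2 : K) ≠ 0) (hϖ : ϖ ≠ 0)
    {b q r s : K} (hU1 : σ (1 + 4 * ϖ * b) * (1 + 4 * ϖ * b) + 4 * ϖ * (σ r * r) = 1) (hU2 : σ s * s + 4 * ϖ * (σ q * q) = 1)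
    (hU3 : σ (1 + 4 * ϖ * b) * q + σ r * s = 0) :
    ((!![1 + 2 * ϖ * b, q, b; 2 * ϖ * r, s, r; 4 * ϖ ^ 2 * b, 2 * ϖ * q, 1 + 2 * ϖ * b] : Matrix (Fin 3) (Fin 3) K).map σ)ᵀ *
        (StdForm.antidiagonal 3).over K * !![1 + 2 * ϖ * b, q, b; 2 * ϖ * r, s, r; 4 * ϖ ^ 2 * b, 2 * ϖ * q, 1 + 2 * ϖ * b] =
      (StdForm.antidiagonal 3).over K := by
  -- `σ` applied to (U3): `(1 + 4ϖσb)… `: `A σq + r σs = 0`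
  have hU3σ : (1 + 4 * ϖ * b) * σ q + r * σ s = 0 := by
    have h := congrArg σ hU3
    rw [map_add, map_mul, map_mul, hσσ, hσσ, map_zero] at h
    exact h
  have hσA : σ (1 + 4 * ϖ * b) = 1 + 4 * ϖ * σ b := by rw [map_add, map_one, map_mul, map_mul, map_ofNat, hσϖ]
  rw [hσA] at hU1 hU3
  rw [antidiagonal_three_over_eq]
  ext i j
  fin_cases i <;> fin_cases j <;>
    simp [Matrix.mul_apply, Fin.sum_univ_three, Matrix.map_apply, map_add, map_mul, map_one, map_ofNat, hσϖ, map_pow]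
  · linear_combination ϖ * hU1
  · linear_combination 2 * ϖ * hU3
  · apply mul_left_cancel₀ h2
    linear_combination hU1
  · linear_combination 2 * ϖ * hU3σ
  · linear_combination hU2
  · linear_combination hU3σ
  · apply mul_left_cancel₀ h2
    linear_combination hU1
  · linear_combination hU3
  · apply mul_left_cancel₀ (mul_ne_zero (mul_ne_zero h2 h2) hϖ)
    linear_combination hU1

include hJ in
/-- **REALISABILITY**: for `b q r s` with (U1)–(U3) there IS `h ∈ Stab(w₀) ≤ U(σ, Φ₃)` with `↑↑h = M(b,q,r,s)` — `M` is invertible (`σ(det M)·det M = 1` from §1), unitary (§1),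
and fixes `w₀ = (1, 0, −2ϖ)` identically. [cite: Flicker1998UnitaryFL, Prop. 4 p. 82] -/
theorem exists_mem_stabilizer_coe_eq_of_relations (hd : LocalConjDatum σ ϖ) {b q r s : K}
    (hU1 : σ (1 + 4 * ϖ * b) * (1 + 4 * ϖ * b) + 4 * ϖ * (σ r * r) = 1) (hU2 : σ s * s + 4 * ϖ * (σ q * q) = 1)
    (hU3 : σ (1 + 4 * ϖ * b) * q + σ r * s = 0) :
    ∃ h : ↥(unitaryGroupOfForm σ J), h ∈ MulAction.stabilizer (↥(unitaryGroupOfForm σ J)) (![1, 0, -(2 * ϖ)] : Fin 3 → K) ∧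
      ((h : GL (Fin 3) K) : Matrix (Fin 3) (Fin 3) K) = !![1 + 2 * ϖ * b, q, b; 2 * ϖ * r, s, r; 4 * ϖ ^ 2 * b, 2 * ϖ * q, 1 + 2 * ϖ * b] := by
  have h20 : (2 : K) ≠ 0 := fun h0 => by have := hd.v2; rw [h0, map_zero] at this; exact zero_ne_one this
  have hid := map_transpose_mul_antidiagonal_mul_eq_of_relations σ hd.σσ hd.σϖ h20 hd.ϖ_ne_zero hU1 hU2 hU3
  -- invertibility from the identity: `σ(det M) · det Φ₃ · det M = det Φ₃`, `det Φ₃ = −1`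
  have hJd : ((StdForm.antidiagonal 3).over K).det = -1 := by
    rw [antidiagonal_three_over_eq, Matrix.det_fin_three]
    simp
  have hdet : (!![1 + 2 * ϖ * b, q, b; 2 * ϖ * r, s, r; 4 * ϖ ^ 2 * b, 2 * ϖ * q, 1 + 2 * ϖ * b] : Matrix (Fin 3) (Fin 3) K).det ≠ 0 := by
    intro h0
    have h := congrArg Matrix.det hid
    rw [Matrix.det_mul, Matrix.det_mul, h0, mul_zero, hJd] at h
    norm_num at h
  refine ⟨⟨Matrix.GeneralLinearGroup.mkOfDetNeZero _ hdet, ?_⟩, ?_, rfl⟩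
  · rw [mem_unitaryGroupOfForm_iff, hJ]
    exact hid
  · rw [mem_stabilizer_anisoVec_iff]
    change (!![1 + 2 * ϖ * b, q, b; 2 * ϖ * r, s, r; 4 * ϖ ^ 2 * b, 2 * ϖ * q, 1 + 2 * ϖ * b] : Matrix (Fin 3) (Fin 3) K) *ᵥ
      ![1, 0, -(2 * ϖ)] = ![1, 0, -(2 * ϖ)]
    ext i
    fin_cases i <;> simp [Matrix.mulVec, dotProduct, Fin.sum_univ_three] <;> ring

/-! ## §2 From the two norm relations: `Stab(w₀) ↔ {(A, q, s) : N(s) + 4ϖN(q) = 1, N(A) = N(s)}` -/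

include hJ in
/-- **`Stab(w₀) ↔ {(A, q, s) : N(s) + 4ϖN(q) = 1 ∧ N(A) = N(s)}`**, the EXISTENCE half: for such `(A, q, s)`, with `b := (A − 1)∕(4ϖ)` and `r := −Aσq∕σs`, the element
`M(b, q, r, s)` lies in `Stab(w₀)` ((U1), (U3) follow from the two norm relations; ★ FILE 1 gives necessity and ★ `stabilizer_ext_of_model` uniqueness).
[cite: Flicker1998UnitaryFL, Prop. 4 p. 82; Prop. 16 p. 96] -/
theorem exists_mem_stabilizer_coe_eq_of_norm_relations (hd : LocalConjDatum σ ϖ) {A q s : K}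
    (hR1 : σ s * s + 4 * ϖ * (σ q * q) = 1) (hR2 : σ A * A = σ s * s) :
    ∃ h : ↥(unitaryGroupOfForm σ J), h ∈ MulAction.stabilizer (↥(unitaryGroupOfForm σ J)) (![1, 0, -(2 * ϖ)] : Fin 3 → K) ∧
      ((h : GL (Fin 3) K) : Matrix (Fin 3) (Fin 3) K) =
        !![1 + 2 * ϖ * ((A - 1) / (4 * ϖ)), q, (A - 1) / (4 * ϖ); 2 * ϖ * (-(A * σ q) / σ s), s, -(A * σ q) / σ s;
           4 * ϖ ^ 2 * ((A - 1) / (4 * ϖ)), 2 * ϖ * q, 1 + 2 * ϖ * ((A - 1) / (4 * ϖ))] := by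
  have h20 : (2 : K) ≠ 0 := fun h0 => by have := hd.v2; rw [h0, map_zero] at this; exact zero_ne_one this
  have h4ϖ : (4 : K) * ϖ ≠ 0 := by rw [show (4 : K) = 2 * 2 by norm_num]; exact mul_ne_zero (mul_ne_zero h20 h20) hd.ϖ_ne_zero
  have hs0 : s ≠ 0 := by
    intro h0; rw [h0, mul_zero, zero_add] at hR1
    -- `4ϖ N(q) = 1` is impossible: odd vs even order
    have hv := congrArg (fun x : K => Valued.v x) hR1
    simp only [map_mul, map_one, hd.vσ] at hv
    have h4 : Valued.v (4 : K) = 1 := by rw [show (4 : K) = 2 * 2 by norm_num, map_mul, hd.v2, one_mul]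
    rw [h4, one_mul, hd.vϖ, ← WithZero.exp_log (show Valued.v q ≠ 0 from fun hq0 => by rw [hq0, mul_zero] at hv; exact zero_ne_one hv),
      ← WithZero.exp_add, ← WithZero.exp_add, ← WithZero.exp_zero, WithZero.exp_inj] at hv
    omega
  have hσs : σ s ≠ 0 := fun h0 => hs0 (by have h := congrArg σ h0; rwa [hd.σσ, map_zero] at h)
  have hϖ0 : ϖ ≠ 0 := hd.ϖ_ne_zero
  have h40 : (4 : K) ≠ 0 := by rw [show (4 : K) = 2 * 2 by norm_num]; exact mul_ne_zero h20 h20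
  have hA : 1 + 4 * ϖ * ((A - 1) / (4 * ϖ)) = A := by field_simp; ring
  refine exists_mem_stabilizer_coe_eq_of_relations σ hJ hd ?_ hR1 ?_
  · -- (U1) from `N(r) = N(A)N(q)∕N(s)`, (U2) and `N(A) = N(s)`
    rw [hA]
    have hσr : σ (-(A * σ q) / σ s) = -(σ A * q) / s := by rw [map_div₀, map_neg, map_mul, hd.σσ, hd.σσ]
    rw [hσr]
    have hss : σ s * s ≠ 0 := mul_ne_zero hσs hs0
    have e : σ A * A + 4 * ϖ * (-(σ A * q) / s * (-(A * σ q) / σ s)) = σ A * A * (σ s * s + 4 * ϖ * (σ q * q)) / (σ s * s) := by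
      field_simp
    rw [e, hR1, mul_one, hR2, div_self hss]
  · rw [hA, map_div₀, map_neg, map_mul, hd.σσ, hd.σσ]
    field_simp
    ring

end UnitaryGroup

end Literature.NumberTheory.Automorphic

end
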